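import Mathlib
import Literature.Analysis.FluidPDE.Tao2016AveragedNS.DSSProfileDictionary
import Summits.NavierStokesRegularity.NavierStokesRegularity.Theorems.WakeRatchetAdmissibleEternalBoundCritical
import HarnessLib

/-!
# From a discretely self-similar (DSS) lattice orbit in PHYSICAL time to an admissible DSS wave
# (`IsDSSWave`), with the per-shell energy ratio `μ = g⁻²` (support for K1(1) =
# `TaoLadderRungTwoBreak.NoSurvivingDSSOne`, stmt-NavierStokesRegularity-20205)

Cell harvest/h2-tao-ladder, seat p2 (NUM-4b STAGE 2, `rung1/STAGE2-LEMMA.md` §1 Lemma 2 remarks and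
§4 COROLLARY), kernel form.  MODEL statement about the cascade lattice ODE of a table `α`
(Tao 2016 §4, normal form `Ẋ_n = Λ^n [Q(X_n) + B(X_{n+1}, X_n)] + Λ^{n-1} A(X_{n-1})`,
`Λ = bigLam ε₀ = (1+ε₀)^{5/2}`); nothing in this file is a statement about the Navier–Stokes
equations, and no item is closed by it.

THE DICTIONARY (what the certified numerics produce ↦ what the route items quantify over).  A
one-shift fixed point of the renormalisation map of the bi-infinite lattice (p2's interval-validated
object) generates a DSS blow-up orbit `U` with blow-up time `t⋆`, amplitude factor `g⁻¹` and time
factor `e^{T} = Λ/g` per shell: `U_k(t⋆ - θ) = g⁻¹ U_{k-1}(t⋆ - e^{T}θ)`.  The tree lemma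
`TaoCascade.isSWave_of_dssOrbit` (p583921) turns shell `0` of such an orbit into the PROFILE
equation.  Here the remaining clauses of `IsDSSWave ε₀ α (Equiv.refl Unit) T Φ` are discharged:

* `isDSSWave_of_dssOrbit`: shell-`0` law on `t < t⋆` + the two DSS relations with the neighbours +
  `U_0` integrable on `(-∞, t⋆)` (finite physical-time action) + `U_0` bounded on some `[t⋆-θ₀, t⋆)`
  ⟹ `Φ(x) := e^{-x} U_0(t⋆ - e^{-x})` is an admissible DSS wave with delay `T` (`mass` is the change
  of variables `WakeRatchetCritical.integrable_recentre_iff`; `bdd` is `e^{2x}‖Φ(x)‖² = ‖U_0(t⋆-e^{-x})‖²`);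
* `dssMu_eq_of_bigLam_eq`: for such a wave `dssMu ε₀ T = (g²)⁻¹` — the per-shift ENERGY RATIO `μ`
  of the numerics —, so `Surviving 1 ε₀ T ↔ 1 < g² ≤ 1 + ε₀` (`surviving_one_iff_of_bigLam_eq`),
  i.e. the cell's `s = (1+ε₀)μ ≥ 1 ∧ μ < 1`;
* `dssProfile_ne_zero`: the wave is non-trivial as soon as `U_0` is somewhere non-zero before `t⋆`.

So an interval certificate of a one-shift DSS fixed point with `g² ∈ (1, 1+ε₀]` is, through this
file, a witness AGAINST `NoSurvivingDSSOne` at that `(R, ε₀)` — it bounds the threshold `ε_s(R)`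
of item 20205 from above (T4, spread 7.5: ε_s < 0.03; VALIDATED numerics, seat engine unaudited);
the remaining non-kernel link is the existence of the orbit from the certificate
(`rung1/STAGE2-LEMMA.md` §2–§4: Schauder–Tychonoff on window box × wake ball × top ball).
-/

noncomputable section

-- `Summit.NavierStokesRegularity.NavierStokesRegularity.…` is the tree's (summit = problem) namespace; the
-- duplicated component is intended, so the dupNamespace linter is silenced for this file.
set_option linter.dupNamespace false

namespace Summit.NavierStokesRegularity.NavierStokesRegularity.Theorems

namespace DSSOneShift

open Filter Topology MeasureTheory Set
open Literature.Analysis.FluidPDE Literature.Analysis.FluidPDE.TaoCascade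
open WakeRatchetCritical

variable {m : ℕ}

/-- **DSS orbit ⟹ admissible DSS wave.**  Let shell `0` of the lattice of the table `α` obey
`U₀' = Q(U₀) + Λ⁻¹A(U₋₁) + B(U₁, U₀)` for `t < t⋆` (the normal form at shell `0`), let the neighbours
be its DSS images (`U₋₁(t⋆-θ) = g U₀(t⋆-e^{-T}θ)`, `U₁(t⋆-θ) = g⁻¹U₀(t⋆-e^{T}θ)`, `θ > 0`) with
`Λ = g e^{T}`, `g > 0`, `T > 0`, and suppose `‖U₀‖` is integrable on `(-∞, t⋆)` and bounded on
`[t⋆-θ₀, t⋆)`.  Then `Φ(x) = e^{-x} U₀(t⋆ - e^{-x})` (one profile, shape permutation `id`) is an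
admissible DSS wave of `α` at scale ratio `1+ε₀` with delay `T`.
[cite: Tao2016AveragedNS, §4 Lemma 4.1 (4.8), §5.3–§6 (self-similar variables); cell vocabulary (`IsDSSWave`), harvest/h2-tao-ladder rung1/STAGE2-LEMMA.md §4 Corollary] -/
theorem isDSSWave_of_dssOrbit {ε₀ : ℝ} {α : Fin m → Fin m → Fin m → ℤ × ℤ × ℤ → ℝ}
    {g T tstar θ₀ P : ℝ} (hg : 0 < g) (hT : 0 < T) (hlam : bigLam ε₀ = g * Real.exp T)
    {U₀ Um Up : ℝ → Em m}
    (hU : ∀ t, t < tstar → HasDerivAt U₀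
      (tableQ α (U₀ t) + (bigLam ε₀)⁻¹ • tableA α (Um t) + tableB α (Up t) (U₀ t)) t)
    (hm : ∀ θ, 0 < θ → Um (tstar - θ) = g • U₀ (tstar - Real.exp (-T) * θ))
    (hp : ∀ θ, 0 < θ → Up (tstar - θ) = g⁻¹ • U₀ (tstar - Real.exp T * θ))
    (hint : IntegrableOn (fun t => ‖U₀ t‖) (Iio tstar))
    (hθ₀ : 0 < θ₀) (hbd : ∀ θ, 0 < θ → θ ≤ θ₀ → ‖U₀ (tstar - θ)‖ ≤ P) :
    IsDSSWave ε₀ α (Equiv.refl Unit) T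
      (fun _ x => Real.exp (-x) • U₀ (tstar - Real.exp (-x))) := by
  have hlam0 : bigLam ε₀ ≠ 0 := by rw [hlam]; positivity
  refine ⟨hT, ?_, ?_, ?_⟩
  · -- the profile system: tree dictionary lemma + homogeneity of the table maps
    have h := isSWave_of_dssOrbit (Q := tableQ α) (A₀ := fun v => (bigLam ε₀)⁻¹ • tableA α v)
      (B₀ := tableB α) (tableQ_smul α)
      (fun c v => by
        show (bigLam ε₀)⁻¹ • tableA α (c • v) = c ^ 2 • (bigLam ε₀)⁻¹ • tableA α v
        rw [tableA_smul, smul_comm])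
      (fun c v w => by
        show tableB α (c • v) w = c • tableB α v w
        simpa using tableB_smul_smul α c 1 v w)
      (fun c v w => by
        show tableB α v (c • w) = c • tableB α v w
        simpa using tableB_smul_smul α 1 c v w)
      hg hlam hU hm hp
    simp only [smul_smul, mul_inv_cancel₀ hlam0, one_smul] at h
    exact h
  · -- integrable summed mass: change of variables `t = t⋆ - e^{-x}`
    have h := (integrable_recentre_iff U₀ tstar).1.2 hint
    refine (integrable_congr (Filter.Eventually.of_forall fun x => ?_)).1 h
    simp [sMass]
  · -- forward bound of the renormalised energy: `e^{2x}‖Φ(x)‖² = ‖U₀(t⋆ - e^{-x})‖²`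
    refine ⟨-Real.log θ₀, P ^ 2, fun x hx => ?_⟩
    have hle : Real.exp (-x) ≤ θ₀ := by
      have h1 : Real.exp (-x) ≤ Real.exp (Real.log θ₀) := Real.exp_le_exp.2 (by linarith)
      rwa [Real.exp_log hθ₀] at h1
    have hPt := hbd _ (Real.exp_pos _) hle
    have hw : wEnergy 1 (fun _ : Unit => fun x => Real.exp (-x) • U₀ (tstar - Real.exp (-x))) x
        = ‖U₀ (tstar - Real.exp (-x))‖ ^ 2 := by
      simp only [wEnergy, sEnergy, Finset.univ_unique, Finset.sum_singleton, norm_smul,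
        Real.norm_eq_abs, abs_of_pos (Real.exp_pos _), mul_pow, mul_one]
      rw [← mul_assoc, ← Real.exp_nat_mul, ← Real.exp_add]
      have : (2 : ℝ) * x + ((2 : ℕ) : ℝ) * -x = 0 := by push_cast; ring
      rw [this, Real.exp_zero, one_mul]
    rw [hw]
    exact pow_le_pow_left₀ (norm_nonneg _) hPt 2

/-- **The energy ratio of the wave.**  If `Λ = (1+ε₀)^{5/2} = g e^{T}` with `1 + ε₀ > 0` then
`dssMu ε₀ T = e^{2T}/(1+ε₀)^5 = (g²)⁻¹`: the per-shift energy ratio `μ = g⁻²` of a one-shift DSS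
fixed point with renormalisation factor `g`.
[cite: Tao2016AveragedNS, §4 (4.1) (the weight `(1+ε₀)^{5n/2}`); cell vocabulary (`dssMu`)] -/
theorem dssMu_eq_of_bigLam_eq {ε₀ g T : ℝ} (hε : 0 < 1 + ε₀) (hg : 0 < g)
    (hlam : bigLam ε₀ = g * Real.exp T) : dssMu ε₀ T = (g ^ 2)⁻¹ := by
  unfold dssMu
  have h5 : (1 + ε₀) ^ (5 : ℕ) = bigLam ε₀ ^ 2 := by
    unfold bigLam
    rw [← Real.rpow_natCast, ← Real.rpow_mul_natCast hε.le]
    norm_num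
  rw [h5, hlam, mul_pow, ← Real.exp_nat_mul]
  have hg2 : g ^ 2 ≠ 0 := by positivity
  field_simp
  push_cast
  ring_nf

/-- **Survival in terms of `g`.**  With `Λ = g e^{T}`, `1+ε₀ > 0`, `g > 0`:
`Surviving 1 ε₀ T ↔ 1 < g² ∧ g² ≤ 1 + ε₀` (the cell's `μ < 1 ∧ s = (1+ε₀)μ ≥ 1`).
[cite: Tao2016AveragedNS, §4 (the viscous equation before Thm. 4.2); cell vocabulary (`Surviving`)] -/
theorem surviving_one_iff_of_bigLam_eq {ε₀ g T : ℝ} (hε : 0 < 1 + ε₀) (hg : 0 < g)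
    (hlam : bigLam ε₀ = g * Real.exp T) :
    Surviving 1 ε₀ T ↔ 1 < g ^ 2 ∧ g ^ 2 ≤ 1 + ε₀ := by
  unfold Surviving
  rw [dssMu_eq_of_bigLam_eq hε hg hlam, Real.rpow_neg hε.le, Real.rpow_one]
  have hg2 : 0 < g ^ 2 := by positivity
  rw [inv_le_inv₀ hε hg2, inv_lt_one₀ hg2]
  exact and_comm

/-- **Non-triviality.**  If `U₀(t₁) ≠ 0` at some `t₁ < t⋆` then the profile
`Φ(x) = e^{-x} U₀(t⋆ - e^{-x})` is not identically zero (at `x = -log(t⋆ - t₁)`). [folklore] -/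
theorem dssProfile_ne_zero {E : Type*} [NormedAddCommGroup E] [NormedSpace ℝ E] {U₀ : ℝ → E}
    {tstar t₁ : ℝ} (ht₁ : t₁ < tstar) (hne : U₀ t₁ ≠ 0) :
    ¬ ∀ x : ℝ, Real.exp (-x) • U₀ (tstar - Real.exp (-x)) = 0 := by
  intro h
  have hx := h (-Real.log (tstar - t₁))
  rw [neg_neg, Real.exp_log (sub_pos.2 ht₁), sub_sub_cancel, smul_eq_zero] at hx
  rcases hx with hx | hx
  · exact absurd hx (sub_pos.2 ht₁).ne'
  · exact hne hx

end DSSOneShift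

end Summit.NavierStokesRegularity.NavierStokesRegularity.Theorems
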